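import Summits.Langlands.Langlands.Theses.AbelianSurfaceSerre
import Summits.Langlands.Langlands.Theorems.DyadicOddResidueSectorComplementRigidityTransport
import Summits.Langlands.Langlands.Theorems.AbelianSurfaceSerreSurfaceSectorComplementRigidityTransportLAlg
import Summits.Langlands.Langlands.Theorems.DyadicOddResidueSectorComplementJunctionOfFacts
import Literature.NumberTheory.Automorphic.LocalLanglandsGLIndecomposable
import Literature.NumberTheory.GaloisRepresentations.HenniartGaloisSideCharacterisation
import HarnessLib

/-!
# SKELETON — line `Sketch` for the crux `AbelianSurfaceSerre.SurfaceSectorComplement`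
(item stmt-Langlands-17767); lead prover-line-stmt-Langlands-17767-0 (cycle 1), continuation leads
prover-line-stmt-Langlands-17767-c1-0 (cycle 2, 2026-08-17: RESHAPE S1 → S1ʷ) and
prover-line-stmt-Langlands-17767-c6-0 (cycle 7, 2026-08-17: RESHAPE S1ʷ → DISCHARGED modulo the three named
local facts of print F1/F2/F3, which become the stubs `stub_localLanglands_gl`,
`stub_localLanglands_gl_indecomposable`, `stub_henniart2002_thm17a`)

Owned, reshaped copy of the only checked line in the payload
(`Cruxes/SurfaceSectorComplement/Sketch_r1_k2.lean`, crux-ideate r1 k2: typed first lemmas of the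
cards `motivic-purity-lgc`, `weil-restriction-window`, `mod3-weight-collapse`, plus the archimedean
repair `X_hol`).  That file is an ideation sketch, not a composition: none of its lemmas concludes
the crux.  This skeleton supplies the composition every line on this item must have.

The crux is the route's declared COMPLEMENT OF THE SECTOR
`SurfaceSectorComplement := EndTrivialSurfacesModular → _root_.Langlands` (rank 4, "never staff it
from this route"): the rest of `GL_n` reciprocity over all number fields, both directions, every
finite place, for ALL pinned reciprocity data, granted modularity (a.e. Satake form) of the
End-trivial abelian surfaces over `ℚ`.  Kernel-checked position (landed,
`Theorems/AbelianSurfaceSerreSurfaceSectorComplementPosition.lean`, p146326; disprover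
`Cruxes/SurfaceSectorComplement/Disproof.lean`): `Langlands → C`, `¬ C ↔ X ∧ ¬ Langlands`,
`C ↔ ¬ X ∨ Langlands`, and modulo Faltings + geometricity of `H¹` framings `Langlands ↔ X ∧ C`.
No line closes it and this one does not claim to.

Composition (sorry-free glue, this file):

  `SurfaceSectorComplement_of : SurfaceSectorComplement`
    ⟸ `ReciprocityRigidity.langlands_iff_exists_of_rigid_lAlgebraic` (LANDED by this line, cycle 2,
       `Theorems/AbelianSurfaceSerreSurfaceSectorComplementRigidityTransportLAlg.lean`, registered
       sub-goal; imported): under rigidity Rʷ of PINNED reciprocity data on the local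
       components of the L-ALGEBRAIC cuspidal `π`, the 2026-08-16 re-type
       `∀ F, Nonempty (ReciprocityData F) ∧ ∀ 𝓡 …` of the summit is equivalent to its `∃ 𝓡` form
       (direction (A) is quantified over L-algebraic `π`, direction (B) produces them, so the
       transport `ReciprocityRigidity.corresponds_transport` — LANDED by line 18745, p145687,
       imported — is only ever invoked at L-algebraic `π`)
    ⟸ Rʷ `recRigidityLAlg_of_namedFactStubs` (Rʷ spelled out; RESHAPED in cycle 2 from S1
       `stub_recRigidity` = rigidity at ALL cuspidal `π`, on the disprover's kernel-checked mutation
       `Disproof.crux_of_stubs_weak`: S1 was over-strong by exactly the non-algebraic cuspidal spectrum;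
       a registered `sorry` stub S1ʷ `stub_recRigidityLAlg` in cycles 2–6, delegated to the lever R of line
       `Sketch_18745_r1_k1` on the twin frame stmt-Langlands-18745).  CYCLE 7: R HAS LANDED MODULO THE
       NAMED FACTS OF PRINT — `ReciprocityRigidity.recRigidityOnLocalComponents_of_namedFacts : F1 → F2 →
       F3 → R` (`Theorems/DyadicOddResidueSectorComplementJunctionOfFacts.lean`, line 18745 cycle 2, through
       the every-rank generic rigidity `PhantomRMJunctionOfPieces.recGL_eq_of_isGeneric_of_namedFacts`,
       p157386, with its invariant-measure input discharged, p158762) — so S1ʷ is now the sorry-free theorem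
       `recRigidityLAlg_of_namedFactStubs := rigid_lAlgebraic_of_rigid (recRigidityOnLocalComponents_of_
       namedFacts F1 F2 F3)` and the `∀ 𝓡` debt of this frame is carried by three NAMED-FACT stubs whose
       signatures are the Literature `def … : Prop` facts verbatim (the canonical "closed modulo X" form;
       discharging any of them = landing `X_holds` in Literature, a literature-prover debt shared with
       lines 18745 / 13643 / 17925, never a restatement here):
         F1 `stub_localLanglands_gl` : `localLanglands_gl` at every non-archimedean local field (the local
             Langlands correspondence for `GL_n`: Harris–Taylor 2001 Thm A, Henniart 2000; uniqueness
             Henniart 1993 Thm 1.1) — T0, XL;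
         F2 `stub_localLanglands_gl_indecomposable` : `localLanglands_gl_indecomposable` (Henniart 2002
             Thm 1.5 (i), §2.7, §2.9; Zelevinsky 1980 Thm 9.7: essentially square-integrable ↔ indecomposable,
             with `L(s, π × π')` ↔ `L(s, σ ⊗ σ')` on those) — XL;
         F3 `stub_henniart2002_thm17a` : `Henniart2002_isEquivalent_of_rootMultiplicity_eulerFactor_tprod_eq`
             (Henniart 2002 Thm 1.7 (a): a non-irreducible Frobenius-semisimple `σ` of dimension `n ≥ 2` is
             determined by the pole orders at `s = 0` of `L(s, σ ⊗ τ)`, `τ` indecomposable of dimension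
             `< n`; Galois side only, segments combinatorics, §4) — L;
    ⟸ `junctionExists_of_stubs : X → Langlands_∃` (the junction in `∃ 𝓡` form, weaker-or-equal to the
       crux by `junctionExists_of_surfaceSectorComplement`; proved here as the composite of three stubs
       along the hub's EXISTING decomposition of the summit by base field, route `BaseFieldAscent`):
         S2a `stub_reciprocityTRCM_of_sector` : X → reciprocity over totally real and CM fields (the text
             of item stmt-Langlands-1093 `BaseFieldAscent.ReciprocityTRCM`, granted the sector — which
             lives inside it at `F = ℚ`, `n = 4`, direction (B); OPEN CONJECTURE, never delegated; item
             1093 has its own registered line);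
         S2b `stub_ascentConjugationSolvable` : TR ∪ CM ⇒ conjugation-solvable fields (VERBATIM the text
             of item stmt-Langlands-1094 `BaseFieldAscent.AscentConjugationSolvable`; blocked-on that item,
             which has its own registered line);
         S2c `stub_ascentResidual` : conjugation-solvable ⇒ all number fields (VERBATIM the text of item
             stmt-Langlands-1095 `BaseFieldAscent.AscentResidual`; blocked-on that item, own line).
       (Texts inlined, not imported: that route's `closes` predates the `∀ 𝓡` re-type, and importing
       its Theses module would not give the items as hypotheses anyway.)

Registered stubs (the ONLY sorries; cycle 7): F1 `stub_localLanglands_gl`, F2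
`stub_localLanglands_gl_indecomposable`, F3 `stub_henniart2002_thm17a` (named facts of print, verbatim),
S2a `stub_reciprocityTRCM_of_sector`, S2b `stub_ascentConjugationSolvable`, S2c `stub_ascentResidual`.
No definitions.  So, kernel-checked: frame 17767 ⟸ F1 ∧ F2 ∧ F3 ∧ (X → item 1093) ∧ item 1094 ∧ item 1095 —
the frame is a conjunction of OTHER routes' filed items plus three PRINTED local theorems; its whole `∀ 𝓡`
debt is published local mathematics (item-level certificate
`Theorems/AbelianSurfaceSerreSurfaceSectorComplementJunctionOfFacts.lean`:
`F1 → F2 → F3 → (C ↔ (X → Langlands_∃))`); and conversely every stub is implied by the summit modulo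
Chebotarev + Brauer–Nesbitt or is a theorem of print (S2a–S2c outright: `Disproof.langlands_implies_stubS2a/b/c`;
Rʷ: `ReciprocityRigidity.recRigidityLAlg_of_langlands`, p157164) — the line is provably no harder and no
easier than the summit off the sector.  What the sector's printed outward reach (the five idea
cards) would add enters S2a's antecedent only through `EndTrivialSurfacesModular` itself; the cards'
payoffs (`ModThreeResidualModularityGSp4`, `QuadraticEllipticModular`, `EndTrivialSurfacesReciprocal`)
are regions of the leaf B_w / LGC of the shared seam `W → B_w → LGC → JS (2.2) → JS (2.3) → Langlands_∃`
(`Cruxes/SectorToLanglands/Lines/SectorToLanglandsOfLeaves.lean`) of measure zero in S2a, and each needs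
vocabulary the tree lacks (twisted Burkhardt moduli, Weil restriction, weight–monodromy); they are not
registered here (see PICKED.md).
-/

noncomputable section

set_option linter.dupNamespace false

open scoped MatrixGroups NumberField
open NumberField IsDedekindDomain Filter MeasureTheory
open Literature.NumberTheory.Automorphic Literature.NumberTheory.GaloisRepresentations
open Summit.Langlands
open Summit.Langlands.Langlands.Theses.AbelianSurfaceSerre

namespace Summit.Langlands.Langlands.Theorems.AbelianSurfaceSerreComplement

/-! ## §1 Stubs F1–F3 — the three named local facts of print, and Rʷ from them (cycle 7 reshape)

The signatures of F1–F3 are VERBATIM the hypotheses of the landed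
`ReciprocityRigidity.recRigidityOnLocalComponents_of_namedFacts` (line 18745), i.e. the Literature named
facts `localLanglands_gl`, `localLanglands_gl_indecomposable` (both threaded over the `LocalGaloisGroup`
named facts `hmul huniq hn hex hns` and a pinned pair `(d, 𝓔)` of local Artin data / local constants) and
`Henniart2002_isEquivalent_of_rootMultiplicity_eulerFactor_tprod_eq`, each at every non-archimedean local
field of characteristic zero or not (the facts are stated for every `IsNonarchimedeanLocalField`). -/

/-- **Stub F1 (NAMED FACT OF PRINT — the local Langlands correspondence for `GL_n(F)`; T0).**  At every
non-archimedean local field `F`, for every pinned local Artin datum `d` and system of local constants `𝓔`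
with `𝓔.artin F = d`: `localLanglands_gl F … d 𝓔 hd` — existence of a six-clause local Langlands datum
(`rec_n` on irreducible smooth classes of every rank, preserving `L` and `ε` of pairs, compatible with
twists, central characters and contragredients, `rec_1 =` class field theory) together with uniqueness on
supercuspidal classes.  Discharging it = `localLanglands_gl_holds` in Literature (Harris–Taylor 2001
Thm A / Henniart 2000; Henniart 1993 Thm 1.1); shared debt of lines 18745, 13643, 17925, item 17930.
[cite: HarrisTaylorAMS2001, Thm. A] [cite: Henniarts1993, Thm 1.1] -/
theorem stub_localLanglands_gl :
    ∀ (F : Type) [Field F] [ValuativeRel F] [TopologicalSpace F] [IsNonarchimedeanLocalField F]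
      (hmul : @IsFrobPow.mul F _ _ _ _) (huniq : @IsFrobPow.unique F _ _ _ _)
      (hn : absInertia_normal F) (hex : @exists_isFrobPow F _ _ _ _)
      (hns : @WeilGroup.exists_subgroup_le_inertia_isOpen_of_continuous F _ _ _ _)
      (d : LocalArtinData F) (𝓔 : LocalEpsilonSystem F) (hd : 𝓔.artin F = d),
      localLanglands_gl F hmul huniq hn hex hns d 𝓔 hd := by
  sorry

/-- **Stub F2 (NAMED FACT OF PRINT — local Langlands on indecomposable parameters).**  At every
non-archimedean local field: `localLanglands_gl_indecomposable F … d 𝓔 hd` (Henniart 2002 Thm 1.5 (i),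
§2.7, §2.9 with Zelevinsky 1980 Thm 9.7: under `rec_n` the essentially square-integrable classes
correspond to the indecomposable Frobenius-semisimple parameters, with `L`-factors of pairs).  Discharging
it = `localLanglands_gl_indecomposable_holds` in Literature; shared debt of lines 18745, 13643.
[cite: HenniartBSMF2002, Thm. 1.5] -/
theorem stub_localLanglands_gl_indecomposable :
    ∀ (F : Type) [Field F] [ValuativeRel F] [TopologicalSpace F] [IsNonarchimedeanLocalField F]
      (hmul : @IsFrobPow.mul F _ _ _ _) (huniq : @IsFrobPow.unique F _ _ _ _)
      (hn : absInertia_normal F) (hex : @exists_isFrobPow F _ _ _ _)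
      (hns : @WeilGroup.exists_subgroup_le_inertia_isOpen_of_continuous F _ _ _ _)
      (d : LocalArtinData F) (𝓔 : LocalEpsilonSystem F) (hd : 𝓔.artin F = d),
      localLanglands_gl_indecomposable F hmul huniq hn hex hns d 𝓔 hd := by
  sorry

/-- **Stub F3 (NAMED FACT OF PRINT — Henniart 2002 Thm 1.7 (a), Galois side).**  At every
non-archimedean local field: a NON-irreducible Frobenius-semisimple Weil–Deligne representation `σ` of
dimension `n ≥ 2` is determined up to equivalence, among Frobenius-semisimple `σ'` of dimension `n`, by
the pole orders at `s = 0` of `L(s, σ ⊗ τ)` (`rootMultiplicity 1` of the Euler factor of `σ.tprod τ`)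
over the indecomposable Frobenius-semisimple `τ` of dimensions `1 ≤ r ≤ n - 1`.  Elementary in print
(classification by segments, §4); discharging it = `…_holds` in Literature; shared debt of lines 18745,
13643, 17925. [cite: HenniartBSMF2002, Thm. 1.7 (a)] -/
theorem stub_henniart2002_thm17a :
    ∀ (F : Type) [Field F] [ValuativeRel F] [TopologicalSpace F] [IsNonarchimedeanLocalField F],
      Henniart2002_isEquivalent_of_rootMultiplicity_eulerFactor_tprod_eq F := by
  sorry

/-- **Rʷ — rigidity of pinned reciprocity data on the local components of L-ALGEBRAIC cuspidal `π`
(the registered stub S1ʷ `stub_recRigidityLAlg` of cycles 2–6, now a THEOREM modulo F1–F3).**  Any two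
reciprocity data of a number field `K` (both pinned to THE local Artin maps and local constants) have the
same `rec_n` on the local components of the L-algebraic cuspidal automorphic representations of
`GL_n(𝔸_K)`, `n ≥ 1`: the unrestricted rigidity R of line 18745 from the three named facts
(`ReciprocityRigidity.recRigidityOnLocalComponents_of_namedFacts`: local components of cuspidal `π` are
generic, `CuspidalAutomorphicRepData.exists_isGeneric_of_hasLocalComponentAt`; generic rigidity in every
rank, `PhantomRMJunctionOfPieces.recGL_eq_of_isGeneric_of_namedFacts`), restricted to L-algebraic `π`
(`ReciprocityRigidity.rigid_lAlgebraic_of_rigid`, p150410).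
[cite: Henniarts1993, Thm 1.1] [cite: HenniartBSMF2002, Thm. 1.5 and Thm. 1.7 (a)] -/
theorem recRigidityLAlg_of_namedFactStubs :
    ∀ (K : Type) [Field K] [NumberField K] (𝓡 𝓡' : ReciprocityData K) (n : ℕ)
      (hcpt : isCompact_glFiniteIntegralLevel n K), 0 < n →
      ∀ π : CuspidalAutomorphicRepData n K hcpt, π.1.IsLAlgebraic →
        ∀ (v : HeightOneSpectrum (𝓞 K)) (πv : SmoothIrrep (GL (Fin n) (v.adicCompletion K))),
          π.1.HasLocalComponentAt v πv.ρ →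
            (𝓡.llc v).recGL n (IrrClass.mk πv) = (𝓡'.llc v).recGL n (IrrClass.mk πv) :=
  ReciprocityRigidity.rigid_lAlgebraic_of_rigid
    (ReciprocityRigidity.recRigidityOnLocalComponents_of_namedFacts stub_localLanglands_gl
      stub_localLanglands_gl_indecomposable stub_henniart2002_thm17a)

/-! ## §2 Transport of the summit along data rigid on L-algebraic cuspidal `π` — LANDED

`ReciprocityRigidity.corresponds_transport` (line 18745, p145687,
`Theorems/DyadicOddResidueSectorComplementRigidityTransport.lean`) and this line's helper
`Theorems/AbelianSurfaceSerreSurfaceSectorComplementRigidityTransportLAlg.lean` (cycle 2):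
`automorphicToGalois_transport_of_isLAlgebraic`, `galoisToAutomorphic_transport_of_isLAlgebraic`,
`globalLanglands_transport_of_isLAlgebraic`, `langlands_iff_exists_of_rigid_lAlgebraic` (registered
glue sub-goal), `rigid_lAlgebraic_of_rigid` (R → Rʷ) — imported by name, not restated. -/

/-! ## §3 Stubs S2a–S2c — the junction along the base-field decomposition (route `BaseFieldAscent`) -/

/-- **Stub S2a (OPEN CONJECTURE, registered, never delegated): reciprocity over totally real and CM
fields, granted the sector.**  The conclusion is VERBATIM the text of item stmt-Langlands-1093
`BaseFieldAscent.ReciprocityTRCM`: for every totally real or CM number field `F`, SOME pinned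
reciprocity datum for which `GL_n` reciprocity holds in every rank (both directions, all weights,
local–global compatibility at every finite place).  The sector X (a.e.-Satake modularity of End-trivial
abelian surfaces over `ℚ`) is the piece `F = ℚ`, `n = 4`, direction (B), `ρ` a framing of `H¹(A)`,
Satake clause only; everything else here — every known engine (HLTT/Scholze for regular (A),
CHT/BLGGT/10-author for (B)) and the open irregular core (Maass `λ = 1/4`, weight-one type, even and
Hodge-irregular `ρ`) — is untouched by X.
[cite: BuzzardGeeLMS2014, Conj. 3.2.1 and Conj. 3.2.2] [cite: FontaineMazurGeometric1995, Conj. 1] -/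
theorem stub_reciprocityTRCM_of_sector : EndTrivialSurfacesModular →
    ∀ (F : Type) [Field F] [NumberField F], (NumberField.IsTotallyReal F ∨ NumberField.IsCMField F) →
      ∃ R : ReciprocityData F, ∀ n : ℕ, 0 < n →
        ∀ hcpt : Literature.NumberTheory.Automorphic.isCompact_glFiniteIntegralLevel n F,
          GlobalLanglandsCorrespondenceGLn n F R hcpt := by
  sorry

/-- **Stub S2b (= item stmt-Langlands-1094 `BaseFieldAscent.AscentConjugationSolvable`, VERBATIM;
blocked-on that item): reciprocity over TR ∪ CM ⇒ reciprocity over every conjugation-solvable number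
field** (there are a totally real `F₀` and a finite Galois `E ⊇ F ⊇ F₀` with solvable
`Gal(E/F₀)`): cyclic prime layers by Arthur–Clozel base change / automorphic induction, Clifford
theory and de-induction over twists, cyclic descent.
[cite: ArthurClozelAMS120, Ch. 3 Thm 4.2, Thm 6.2] -/
theorem stub_ascentConjugationSolvable :
    (∀ (F : Type) [Field F] [NumberField F], (NumberField.IsTotallyReal F ∨ NumberField.IsCMField F) →
      ∃ R : ReciprocityData F, ∀ n : ℕ, 0 < n →
        ∀ hcpt : Literature.NumberTheory.Automorphic.isCompact_glFiniteIntegralLevel n F,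
          GlobalLanglandsCorrespondenceGLn n F R hcpt) →
    ∀ (F : Type) [Field F] [NumberField F],
      (∃ (F₀ E : Type) (_ : Field F₀) (_ : NumberField F₀) (_ : Field E) (_ : NumberField E)
          (_ : Algebra F₀ F) (_ : Algebra F E) (_ : Algebra F₀ E) (_ : IsScalarTower F₀ F E)
          (_ : IsGalois F₀ E), NumberField.IsTotallyReal F₀ ∧ IsSolvable (E ≃ₐ[F₀] E)) →
      ∃ R : ReciprocityData F, ∀ n : ℕ, 0 < n →
        ∀ hcpt : Literature.NumberTheory.Automorphic.isCompact_glFiniteIntegralLevel n F,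
          GlobalLanglandsCorrespondenceGLn n F R hcpt := by
  sorry

/-- **Stub S2c (= item stmt-Langlands-1095 `BaseFieldAscent.AscentResidual`, VERBATIM; blocked-on
that item): reciprocity over all conjugation-solvable fields ⇒ reciprocity over ALL number fields**
(the residual class `[F : F^tr] ≥ 5` with insoluble conjugation-closure is one non-solvable base
change / automorphic induction / descent away).  Its conclusion is `Langlands_∃`.
[cite: BuzzardGeeLMS2014, Conj. 3.2.2] -/
theorem stub_ascentResidual :
    (∀ (F : Type) [Field F] [NumberField F],
      (∃ (F₀ E : Type) (_ : Field F₀) (_ : NumberField F₀) (_ : Field E) (_ : NumberField E)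
          (_ : Algebra F₀ F) (_ : Algebra F E) (_ : Algebra F₀ E) (_ : IsScalarTower F₀ F E)
          (_ : IsGalois F₀ E), NumberField.IsTotallyReal F₀ ∧ IsSolvable (E ≃ₐ[F₀] E)) →
      ∃ R : ReciprocityData F, ∀ n : ℕ, 0 < n →
        ∀ hcpt : Literature.NumberTheory.Automorphic.isCompact_glFiniteIntegralLevel n F,
          GlobalLanglandsCorrespondenceGLn n F R hcpt) →
    ∀ (F : Type) [Field F] [NumberField F], ∃ R : ReciprocityData F, ∀ n : ℕ, 0 < n →
      ∀ hcpt : Literature.NumberTheory.Automorphic.isCompact_glFiniteIntegralLevel n F,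
        GlobalLanglandsCorrespondenceGLn n F R hcpt := by
  sorry

/-- **The junction in `∃ 𝓡` form from S2a–S2c**: `X → Langlands_∃`, two modus ponens along the
base-field decomposition (the shape of `BaseFieldAscent.closes`). [folklore] -/
theorem junctionExists_of_stubs : EndTrivialSurfacesModular →
    ∀ (F : Type) [Field F] [NumberField F], ∃ 𝓡 : ReciprocityData F, ∀ n : ℕ, 0 < n →
      ∀ hcpt : isCompact_glFiniteIntegralLevel n F, GlobalLanglandsCorrespondenceGLn n F 𝓡 hcpt :=
  fun hX ↦ stub_ascentResidual (stub_ascentConjugationSolvable (stub_reciprocityTRCM_of_sector hX))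

/-- **The crux BY NAME from the registered stubs**: Rʷ (from F1–F3) through the landed
`ReciprocityRigidity.langlands_iff_exists_of_rigid_lAlgebraic`, then the junction S2a–S2c. -/
theorem SurfaceSectorComplement_of : SurfaceSectorComplement :=
  fun hX ↦ (ReciprocityRigidity.langlands_iff_exists_of_rigid_lAlgebraic
    recRigidityLAlg_of_namedFactStubs).2 (junctionExists_of_stubs hX)

/-! ## §4 The transfer loses nothing -/

/-- The crux gives the `∃`-form of the junction with NO further hypothesis (so the composite of
S2a–S2c is weaker-or-equal to the crux, and the transfer along Rʷ is not a costume). [folklore] -/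
theorem junctionExists_of_surfaceSectorComplement (hC : SurfaceSectorComplement)
    (hX : EndTrivialSurfacesModular) :
    ∀ (F : Type) [Field F] [NumberField F], ∃ 𝓡 : ReciprocityData F, ∀ n : ℕ, 0 < n →
      ∀ hcpt : isCompact_glFiniteIntegralLevel n F, GlobalLanglandsCorrespondenceGLn n F 𝓡 hcpt := by
  intro F _ _
  obtain ⟨⟨𝓡⟩, hall⟩ := hC hX F
  exact ⟨𝓡, hall 𝓡⟩

end Summit.Langlands.Langlands.Theorems.AbelianSurfaceSerreComplement

end
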